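import Summits.Ventures.LatticeQCDFlow.TrivializingMaps.FisherStaircase
import Summits.Ventures.LatticeQCDFlow.TrivializingMaps.FisherStaircaseLength

/-!
HONEST FRAMING: exact (Metropolis-corrected) sampling algorithms for lattice gauge theory; figures of
merit are autocorrelation/cost numbers at stated couplings and volumes; no continuum-physics claim.

# FisherStaircaseTight — THEOREM S♯: the Fisher staircase law is two-sided (THEORY-1.md §31.7)

Proposed tree path: `Summits/Ventures/LatticeQCDFlow/TrivializingMaps/FisherStaircaseTight.lean`
(OURS — venture work, never `Literature/`). Cell `lqcd-flow` (pub-lqcd), unit `pub-lqcd-theory1-g19`,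
2026-08-22. Imports the tree files `FisherStaircase` (THEOREM S: one stage reaches EXACTLY the distance
to the Fisher zero set; `Staircase.step_le_of_stage_summable`, the converse
`logDeriv_taylor_hasSum_of_zeroFree`) and `FisherStaircaseLength` (the length form: every
`η`-margined `K`-stage staircase has `∫ dt/ρ ≤ K·log(1/η)`). Everything PROVED, 0 sorries, no
definitions.

## Content

THEOREM S (`FisherStaircaseLength`, `FisherStaircaseZeroSet`) is a LOWER bound on the number of
perturbative stages: `K · log(1/η) ≥ ℓ_F([x₀, x_K]) := ∫_{x₀}^{x_K} dt / dist(t, F)`, `F` the Fisher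
zero set. This file proves the matching UPPER bound, so that the stage count IS the quasihyperbolic
length of the coupling interval in `ℂ ∖ F` up to constants depending only on the margin:

* §1 (pure, any positive 1-Lipschitz gauge `ρ`). A FULL step `x_{k+1} - x_k ≥ c·ρ(x_k)` (`c ≥ 0`)
  has `ρ`-length at least `log(1 + c)` (`ρ(t) ≤ ρ(x_k) + (t - x_k)`;
  `Staircase.log_le_integral_inv_of_fullStep`), hence `K · log(1 + c) ≤ ∫_{x₀}^{x_K} dt/ρ(t)` for
  a chain of `K` full steps (`Staircase.mul_log_le_integral_inv`), `≤ ℓ_ρ([x₀, β])` while `x_K ≤ β`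
  (`Staircase.mul_log_le_integral_inv_of_le`); with `ρ = dist(·, F)`
  (`Staircase.mul_log_le_integral_inv_infDist`) a full-step chain PASSES `β` as soon as
  `K · log(1 + c) > ℓ_F([x₀, β])` (`Staircase.exists_lt_of_integral_inv_infDist_lt`); the greedy chain
  `x_{k+1} = x_k + c · dist(x_k, F)` exists from every start (`Staircase.exists_greedyChain`).
* §2 (docked to `Z(s) = ∫ D[U] e^{-sS}` on `SU(n)^{E}`, any smooth action with a Fisher zero). A stage
  centred at a real coupling `x` IS summable at every real point closer than `dist(x, F_Z)`
  (`Staircase.actionZ_stage_summable_of_lt_infDist` — the zero-free disc and the converse half of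
  THEOREM F″); hence for `η < 1`, `0 ≤ θ < 1` the greedy `θ`-staircase
  `x_{k+1} = x_k + (1-η)θ · dist(x_k, F_Z)` is an `η`-MARGINED ADMISSIBLE staircase in exactly the
  sense of `FisherStaircase` / `FisherStaircaseZeroSet` (`Staircase.actionZ_greedy_admissible`), and it
  passes every coupling `β` within `ℓ_{F_Z}([x₀, β]) / log(1 + (1-η)θ) + 1` stages
  (`Staircase.actionZ_greedy_mul_log_le`, `Staircase.actionZ_greedy_passes`).
* §3 Wilson corollaries (`S = ambWilsonAction`).

TWO-SIDED LAW (this file + `FisherStaircaseZeroSet.Staircase.actionZ_integral_inv_infDist_le`): the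
minimal number `K_min(x₀ → β; η)` of `η`-margined stages of re-expanded flow-constant series from
`x₀` past `β` obeys `ℓ/log(1/η) ≤ K_min ≤ ℓ/log(1 + (1-η)θ) + 1` for every `θ < 1`,
`ℓ = ℓ_{F_Z}([x₀, β])`; at `η = ½`: `1.44 ℓ ≤ K_min ≤ 2.47 ℓ + 1` (`θ → 1`). Depth in STAGES of this
analytic-continuation scheme is the quasihyperbolic length of the coupling path in the complement of
the Fisher zero set — no more, no less. NOT CLAIMED: anything about other schemes; any location of a
Fisher zero for any `L`, `β`; any cost, autocorrelation or continuum statement; the order `N` inside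
a stage.

References: M. Lüscher, Commun. Math. Phys. 293 (2010) 899 [Luscher2010Trivializing] (the flow-constant
series = stage 0); F. W. Gehring, B. P. Palka, J. Analyse Math. 30 (1976) 172 (quasihyperbolic metric).
-/

open MeasureTheory ProbabilityTheory Filter Topology Complex Set Metric
open Literature.MathematicalPhysics.QuantumFieldTheory
open Literature.MathematicalPhysics.QuantumFieldTheory.Luscher2010
open Literature.MathematicalPhysics.QuantumFieldTheory.WilsonFlow (coeConfig continuous_coeConfig)
open scoped Matrix Matrix.Norms.Frobenius ContDiff

namespace Summit.Ventures.LatticeQCDFlow.TrivializingMaps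

namespace Staircase

/-! ## §1. Full steps have gauge-length at least `log(1 + c)` (pure) -/

/-- **One full step has `ρ`-length at least `log(1 + c)`.** If `ρ` is 1-Lipschitz and positive,
`c ≥ 0` and `c·ρ(a) ≤ b - a`, then `log(1 + c) ≤ ∫_a^b dt/ρ(t)`: on `[a, b]`,
`ρ(t) ≤ ρ(a) + (t - a)` and `∫_a^b dt/(ρ(a) + (t - a)) = log((ρ(a) + b - a)/ρ(a)) ≥ log(1 + c)`.
[ours] -/
theorem log_le_integral_inv_of_fullStep {ρ : ℝ → ℝ} (hρ : ∀ t t', ρ t ≤ ρ t' + |t - t'|)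
    (hpos : ∀ t, 0 < ρ t) {c a b : ℝ} (hc : 0 ≤ c) (hstep : c * ρ a ≤ b - a) :
    Real.log (1 + c) ≤ ∫ t in a..b, (ρ t)⁻¹ := by
  have hcinv : Continuous fun t => (ρ t)⁻¹ :=
    (continuous_of_le_add_abs hρ).inv₀ fun t => (hpos t).ne'
  set d := ρ a with hd_def
  have hd : 0 < d := hpos a
  have hab : a ≤ b := by nlinarith
  have hdenpos : ∀ t ∈ Icc a b, 0 < t + (d - a) := fun t ht => by linarith [ht.1]
  -- pointwise minorant `(t + (d - a))⁻¹ ≤ (ρ t)⁻¹`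
  have hmin : ∀ t ∈ Icc a b, (t + (d - a))⁻¹ ≤ (ρ t)⁻¹ := by
    intro t ht
    have h1 : ρ t ≤ d + (t - a) := by
      have := hρ t a
      rwa [abs_of_nonneg (by linarith [ht.1])] at this
    exact inv_anti₀ (hpos t) (by linarith)
  have hgcont : ContinuousOn (fun t => (t + (d - a))⁻¹) (uIcc a b) := by
    rw [uIcc_of_le hab]
    exact (continuousOn_id.add continuousOn_const).inv₀ fun t ht => (hdenpos t ht).ne'
  have hmono := intervalIntegral.integral_mono_on hab (hgcont.intervalIntegrable (μ := volume))
    (hcinv.intervalIntegrable a b) hmin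
  -- evaluate the minorant's integral
  have heval : ∫ t in a..b, (t + (d - a))⁻¹ = Real.log ((b + (d - a)) / d) := by
    rw [intervalIntegral.integral_comp_add_right (fun u => u⁻¹) (d - a), integral_inv]
    · congr 1
      ring
    · exact notMem_uIcc_of_lt (by linarith) (by linarith)
  rw [heval] at hmono
  refine le_trans ?_ hmono
  have h1c : 0 < 1 + c := by linarith
  rw [Real.log_le_log_iff h1c (div_pos (by linarith) hd), le_div_iff₀ hd]
  nlinarith

/-- **A chain of `K` full steps has `ρ`-length at least `K · log(1 + c)`**: for a positive
1-Lipschitz gauge `ρ`, `c ≥ 0` and `c·ρ(x_k) ≤ x_{k+1} - x_k` for `k < K`,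
`K · log(1 + c) ≤ ∫_{x₀}^{x_K} dt/ρ(t)`. [ours] -/
theorem mul_log_le_integral_inv {ρ : ℝ → ℝ} (hρ : ∀ t t', ρ t ≤ ρ t' + |t - t'|)
    (hpos : ∀ t, 0 < ρ t) {c : ℝ} (hc : 0 ≤ c) {x : ℕ → ℝ} {K : ℕ}
    (h : ∀ k < K, c * ρ (x k) ≤ x (k + 1) - x k) :
    K * Real.log (1 + c) ≤ ∫ t in x 0..x K, (ρ t)⁻¹ := by
  have hcinv : Continuous fun t => (ρ t)⁻¹ :=
    (continuous_of_le_add_abs hρ).inv₀ fun t => (hpos t).ne'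
  induction K with
  | zero => simp
  | succ K ih =>
    have hK := ih fun k hk => h k (Nat.lt_succ_of_lt hk)
    have hstep := log_le_integral_inv_of_fullStep hρ hpos hc (h K (Nat.lt_succ_self K))
    rw [← intervalIntegral.integral_add_adjacent_intervals (hcinv.intervalIntegrable (x 0) (x K))
      (hcinv.intervalIntegrable (x K) (x (K + 1)))]
    push_cast
    linarith

/-- **While the chain has not passed `β`, its stage count is at most `ℓ_ρ([x₀, β])/log(1 + c)`**:
under the hypotheses of `mul_log_le_integral_inv`, if `x_K ≤ β` then
`K · log(1 + c) ≤ ∫_{x₀}^{β} dt/ρ(t)`. [ours] -/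
theorem mul_log_le_integral_inv_of_le {ρ : ℝ → ℝ} (hρ : ∀ t t', ρ t ≤ ρ t' + |t - t'|)
    (hpos : ∀ t, 0 < ρ t) {c : ℝ} (hc : 0 ≤ c) {x : ℕ → ℝ} {K : ℕ}
    (h : ∀ k < K, c * ρ (x k) ≤ x (k + 1) - x k) {β : ℝ} (hK : x K ≤ β) :
    K * Real.log (1 + c) ≤ ∫ t in x 0..β, (ρ t)⁻¹ := by
  have hcinv : Continuous fun t => (ρ t)⁻¹ :=
    (continuous_of_le_add_abs hρ).inv₀ fun t => (hpos t).ne'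
  have h1 := mul_log_le_integral_inv hρ hpos hc h
  have h2 : 0 ≤ ∫ t in x K..β, (ρ t)⁻¹ :=
    intervalIntegral.integral_nonneg hK fun t _ => (inv_pos.mpr (hpos t)).le
  rw [← intervalIntegral.integral_add_adjacent_intervals (hcinv.intervalIntegrable (x 0) (x K))
    (hcinv.intervalIntegrable (x K) β)]
  linarith

/-- **Full steps w.r.t. a closed obstacle set.** `F ⊂ ℂ` closed, nonempty, without real points;
`c ≥ 0`; `c · dist(x_k, F) ≤ x_{k+1} - x_k` for `k < K`; `x_K ≤ β`. Then
`K · log(1 + c) ≤ ∫_{x₀}^{β} dt / dist(t, F)`. [ours] -/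
theorem mul_log_le_integral_inv_infDist {F : Set ℂ} (hF : IsClosed F) (hne : F.Nonempty)
    (hreal : ∀ t : ℝ, (t : ℂ) ∉ F) {c : ℝ} (hc : 0 ≤ c) {x : ℕ → ℝ} {K : ℕ}
    (h : ∀ k < K, c * infDist (x k : ℂ) F ≤ x (k + 1) - x k) {β : ℝ} (hK : x K ≤ β) :
    K * Real.log (1 + c) ≤ ∫ t in x 0..β, (infDist (t : ℂ) F)⁻¹ :=
  mul_log_le_integral_inv_of_le (ρ := fun t : ℝ => infDist (t : ℂ) F) (infDist_ofReal_le_add_abs F)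
    (fun t => (hF.notMem_iff_infDist_pos hne).1 (hreal t)) hc h hK

/-- **A full-step chain passes `β` once `K · log(1 + c)` exceeds the quasihyperbolic length of
`[x₀, β]`**: under the hypotheses of `mul_log_le_integral_inv_infDist` (without `x_K ≤ β`), if
`∫_{x₀}^{β} dt/dist(t, F) < K · log(1 + c)` then `β < x_k` for some `k ≤ K`. [ours] -/
theorem exists_lt_of_integral_inv_infDist_lt {F : Set ℂ} (hF : IsClosed F) (hne : F.Nonempty)
    (hreal : ∀ t : ℝ, (t : ℂ) ∉ F) {c : ℝ} (hc : 0 ≤ c) {x : ℕ → ℝ} {K : ℕ}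
    (h : ∀ k < K, c * infDist (x k : ℂ) F ≤ x (k + 1) - x k) {β : ℝ}
    (hlt : ∫ t in x 0..β, (infDist (t : ℂ) F)⁻¹ < K * Real.log (1 + c)) :
    ∃ k ≤ K, β < x k := by
  by_contra hcon
  have hK : x K ≤ β := not_lt.mp fun hβ => hcon ⟨K, le_rfl, hβ⟩
  have := mul_log_le_integral_inv_infDist hF hne hreal hc h hK
  linarith

/-- The greedy chain `x_{k+1} = x_k + c · dist(x_k, F)` exists from every start `a`. -/
theorem exists_greedyChain (F : Set ℂ) (a c : ℝ) :
    ∃ x : ℕ → ℝ, x 0 = a ∧ ∀ k, x (k + 1) = x k + c * infDist (x k : ℂ) F :=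
  ⟨fun k => Nat.rec a (fun _ t => t + c * infDist (t : ℂ) F) k, rfl, fun _ => rfl⟩

end Staircase

/-! ## §2. Docked: the greedy staircase is admissible and passes `β` in `O(ℓ)` stages -/

section ActionZ

variable {d L n : ℕ} [NeZero L] {B : SuBasis n} {S : AmbConfig d L n → ℝ}

namespace Staircase

/-- **A stage converges up to the zero set (converse half of THEOREM F″, docked).** For a smooth
action, the stage centred at the real coupling `x` — the Taylor series of `Z′/Z` at `x` — is
summable at every real point `p` with `|p - x| < dist(x, F_Z)`: the disc `B(x, dist(x, F_Z))` is
zero-free. [ours] -/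
theorem actionZ_stage_summable_of_lt_infDist (hS : ContDiff ℝ ∞ S) {x p : ℝ}
    (hp : |p - x| < infDist (x : ℂ) {s : ℂ | complexMGF (fun U => -S (coeConfig U))
      (trivialMeasure (Matrix.specialUnitaryGroup (Fin n) ℂ) d L) s = 0}) :
    Summable fun j : ℕ => (j.factorial : ℂ)⁻¹ *
      iteratedDeriv j (fun w => deriv (complexMGF (fun U => -S (coeConfig U))
          (trivialMeasure (Matrix.specialUnitaryGroup (Fin n) ℂ) d L)) w /
        complexMGF (fun U => -S (coeConfig U))
          (trivialMeasure (Matrix.specialUnitaryGroup (Fin n) ℂ) d L) w) x *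
      ((p : ℂ) - x) ^ j := by
  set Z := complexMGF (fun U => -S (coeConfig U))
    (trivialMeasure (Matrix.specialUnitaryGroup (Fin n) ℂ) d L) with hZdef
  set R := infDist (x : ℂ) {s : ℂ | Z s = 0} with hRdef
  have hZon : DifferentiableOn ℂ Z (ball (x : ℂ) R) :=
    (differentiable_actionZ (d := d) (L := L) (n := n) hS).differentiableOn
  have hfree : ∀ w ∈ ball (x : ℂ) R, Z w ≠ 0 := fun w hw h0 =>
    (Set.disjoint_left.mp (disjoint_ball_infDist (x := (x : ℂ)) (s := {s : ℂ | Z s = 0})) hw) h0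
  have hs : (p : ℂ) ∈ ball (x : ℂ) R := by
    rw [mem_ball, dist_eq_norm, ← ofReal_sub, norm_real, Real.norm_eq_abs]
    exact hp
  exact (logDeriv_taylor_hasSum_of_zeroFree hZon hfree hs).summable

/-- **The greedy `θ`-staircase is an `η`-margined admissible staircase.** For a smooth action with
a Fisher zero, `η < 1`, `0 ≤ θ < 1`, and the chain `x_{k+1} = x_k + (1-η)θ·dist(x_k, F_Z)`: every
stage `k` is summable at `x_k + Δ_k/(1-η) = x_k + θ·dist(x_k, F_Z)` — the admissibility hypothesis
of `actionZ_count_ge` / `actionZ_arsinh_sub_le` / `actionZ_integral_inv_infDist_le`. [ours] -/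
theorem actionZ_greedy_admissible (hS : ContDiff ℝ ∞ S) {s₀ : ℂ}
    (hz : complexMGF (fun U => -S (coeConfig U))
      (trivialMeasure (Matrix.specialUnitaryGroup (Fin n) ℂ) d L) s₀ = 0)
    {η θ : ℝ} (hη1 : η < 1) (hθ0 : 0 ≤ θ) (hθ1 : θ < 1) {x : ℕ → ℝ}
    (hx : ∀ k, x (k + 1) = x k + (1 - η) * θ * infDist (x k : ℂ) {s : ℂ |
      complexMGF (fun U => -S (coeConfig U))
        (trivialMeasure (Matrix.specialUnitaryGroup (Fin n) ℂ) d L) s = 0}) (k : ℕ) :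
    Summable fun j : ℕ => (j.factorial : ℂ)⁻¹ *
      iteratedDeriv j (fun w => deriv (complexMGF (fun U => -S (coeConfig U))
          (trivialMeasure (Matrix.specialUnitaryGroup (Fin n) ℂ) d L)) w /
        complexMGF (fun U => -S (coeConfig U))
          (trivialMeasure (Matrix.specialUnitaryGroup (Fin n) ℂ) d L) w) (x k) *
      (((x k + (x (k + 1) - x k) / (1 - η) : ℝ) : ℂ) - x k) ^ j := by
  refine actionZ_stage_summable_of_lt_infDist (d := d) (L := L) (n := n) hS ?_
  set D := infDist (x k : ℂ) {s : ℂ | complexMGF (fun U => -S (coeConfig U))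
    (trivialMeasure (Matrix.specialUnitaryGroup (Fin n) ℂ) d L) s = 0} with hDdef
  have hD : 0 < D := ((isClosed_eq (differentiable_actionZ (d := d) (L := L) (n := n)
    hS).continuous continuous_const).notMem_iff_infDist_pos ⟨s₀, hz⟩).1
    (actionZ_ofReal_ne_zero (d := d) (L := L) (n := n) hS (x k))
  have h1η : 0 < 1 - η := sub_pos.mpr hη1
  have hΔ : x k + (x (k + 1) - x k) / (1 - η) - x k = θ * D := by
    rw [hx k]
    field_simp
    ring
  rw [hΔ, abs_of_nonneg (mul_nonneg hθ0 hD.le)]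
  calc θ * D < 1 * D := mul_lt_mul_of_pos_right hθ1 hD
    _ = D := one_mul D

/-- **THEOREM S♯ — the greedy staircase count is at most the quasihyperbolic length over
`log(1 + (1-η)θ)`.** For a smooth action with a Fisher zero, `η < 1`, `0 ≤ θ`, the chain
`x_{k+1} = x_k + (1-η)θ·dist(x_k, F_Z)` and any `β` with `x_K ≤ β`:
`K · log(1 + (1-η)θ) ≤ ∫_{x₀}^{β} dt / dist(t, F_Z)`. [ours] -/
theorem actionZ_greedy_mul_log_le (hS : ContDiff ℝ ∞ S) {s₀ : ℂ}
    (hz : complexMGF (fun U => -S (coeConfig U))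
      (trivialMeasure (Matrix.specialUnitaryGroup (Fin n) ℂ) d L) s₀ = 0)
    {η θ : ℝ} (hη1 : η < 1) (hθ0 : 0 ≤ θ) {x : ℕ → ℝ}
    (hx : ∀ k, x (k + 1) = x k + (1 - η) * θ * infDist (x k : ℂ) {s : ℂ |
      complexMGF (fun U => -S (coeConfig U))
        (trivialMeasure (Matrix.specialUnitaryGroup (Fin n) ℂ) d L) s = 0})
    {K : ℕ} {β : ℝ} (hK : x K ≤ β) :
    K * Real.log (1 + (1 - η) * θ) ≤ ∫ t in x 0..β, (infDist (t : ℂ) {s : ℂ |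
      complexMGF (fun U => -S (coeConfig U))
        (trivialMeasure (Matrix.specialUnitaryGroup (Fin n) ℂ) d L) s = 0})⁻¹ :=
  mul_log_le_integral_inv_infDist (isClosed_eq (differentiable_actionZ (d := d) (L := L) (n := n)
    hS).continuous continuous_const) ⟨s₀, hz⟩
    (fun t => actionZ_ofReal_ne_zero (d := d) (L := L) (n := n) hS t)
    (mul_nonneg (sub_pos.mpr hη1).le hθ0) (fun k _ => by rw [hx k]; ring_nf; rfl) hK

/-- **THEOREM S♯ — the greedy staircase passes every coupling in `O(ℓ)` stages.** Under the
hypotheses of `actionZ_greedy_mul_log_le` (without `x_K ≤ β`): if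
`∫_{x₀}^{β} dt/dist(t, F_Z) < K · log(1 + (1-η)θ)` then `β < x_k` for some `k ≤ K`. With
`actionZ_greedy_admissible` and THEOREM S this pins the minimal number of `η`-margined stages from
`x₀` past `β` between `ℓ/log(1/η)` and `ℓ/log(1 + (1-η)θ) + 1`, `ℓ = ∫_{x₀}^{β} dt/dist(t, F_Z)`.
[ours] -/
theorem actionZ_greedy_passes (hS : ContDiff ℝ ∞ S) {s₀ : ℂ}
    (hz : complexMGF (fun U => -S (coeConfig U))
      (trivialMeasure (Matrix.specialUnitaryGroup (Fin n) ℂ) d L) s₀ = 0)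
    {η θ : ℝ} (hη1 : η < 1) (hθ0 : 0 ≤ θ) {x : ℕ → ℝ}
    (hx : ∀ k, x (k + 1) = x k + (1 - η) * θ * infDist (x k : ℂ) {s : ℂ |
      complexMGF (fun U => -S (coeConfig U))
        (trivialMeasure (Matrix.specialUnitaryGroup (Fin n) ℂ) d L) s = 0})
    {K : ℕ} {β : ℝ}
    (hlt : ∫ t in x 0..β, (infDist (t : ℂ) {s : ℂ | complexMGF (fun U => -S (coeConfig U))
        (trivialMeasure (Matrix.specialUnitaryGroup (Fin n) ℂ) d L) s = 0})⁻¹ <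
      K * Real.log (1 + (1 - η) * θ)) :
    ∃ k ≤ K, β < x k :=
  exists_lt_of_integral_inv_infDist_lt (isClosed_eq (differentiable_actionZ (d := d) (L := L)
    (n := n) hS).continuous continuous_const) ⟨s₀, hz⟩
    (fun t => actionZ_ofReal_ne_zero (d := d) (L := L) (n := n) hS t)
    (mul_nonneg (sub_pos.mpr hη1).le hθ0) (fun k _ => by rw [hx k]; ring_nf; rfl) hlt

end Staircase

end ActionZ

/-! ## §3 Wilson action -/

section Wilson

variable {d L n : ℕ} [NeZero L]

/-- **Wilson action: the greedy `θ`-staircase is `η`-admissible** (`actionZ_greedy_admissible` with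
`S = S_W`). [ours] -/
theorem wilson_greedy_admissible {s₀ : ℂ}
    (hz : complexMGF (fun U => -ambWilsonAction (coeConfig U))
      (trivialMeasure (Matrix.specialUnitaryGroup (Fin n) ℂ) d L) s₀ = 0)
    {η θ : ℝ} (hη1 : η < 1) (hθ0 : 0 ≤ θ) (hθ1 : θ < 1) {x : ℕ → ℝ}
    (hx : ∀ k, x (k + 1) = x k + (1 - η) * θ * infDist (x k : ℂ) {s : ℂ |
      complexMGF (fun U => -ambWilsonAction (coeConfig U))
        (trivialMeasure (Matrix.specialUnitaryGroup (Fin n) ℂ) d L) s = 0}) (k : ℕ) :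
    Summable fun j : ℕ => (j.factorial : ℂ)⁻¹ *
      iteratedDeriv j (fun w => deriv (complexMGF (fun U => -ambWilsonAction (coeConfig U))
          (trivialMeasure (Matrix.specialUnitaryGroup (Fin n) ℂ) d L)) w /
        complexMGF (fun U => -ambWilsonAction (coeConfig U))
          (trivialMeasure (Matrix.specialUnitaryGroup (Fin n) ℂ) d L) w) (x k) *
      (((x k + (x (k + 1) - x k) / (1 - η) : ℝ) : ℂ) - x k) ^ j :=
  Staircase.actionZ_greedy_admissible (d := d) (L := L) (n := n) contDiff_ambWilsonAction hz hη1
    hθ0 hθ1 hx k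

/-- **Wilson action: the greedy staircase passes every coupling `β` within
`ℓ_{F_Z}([x₀, β])/log(1 + (1-η)θ) + 1` stages** (`actionZ_greedy_passes` with `S = S_W`). [ours] -/
theorem wilson_greedy_passes {s₀ : ℂ}
    (hz : complexMGF (fun U => -ambWilsonAction (coeConfig U))
      (trivialMeasure (Matrix.specialUnitaryGroup (Fin n) ℂ) d L) s₀ = 0)
    {η θ : ℝ} (hη1 : η < 1) (hθ0 : 0 ≤ θ) {x : ℕ → ℝ}
    (hx : ∀ k, x (k + 1) = x k + (1 - η) * θ * infDist (x k : ℂ) {s : ℂ |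
      complexMGF (fun U => -ambWilsonAction (coeConfig U))
        (trivialMeasure (Matrix.specialUnitaryGroup (Fin n) ℂ) d L) s = 0})
    {K : ℕ} {β : ℝ}
    (hlt : ∫ t in x 0..β, (infDist (t : ℂ) {s : ℂ |
        complexMGF (fun U => -ambWilsonAction (coeConfig U))
          (trivialMeasure (Matrix.specialUnitaryGroup (Fin n) ℂ) d L) s = 0})⁻¹ <
      K * Real.log (1 + (1 - η) * θ)) :
    ∃ k ≤ K, β < x k :=
  Staircase.actionZ_greedy_passes (d := d) (L := L) (n := n) contDiff_ambWilsonAction hz hη1 hθ0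
    hx hlt

end Wilson

end Summit.Ventures.LatticeQCDFlow.TrivializingMaps
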